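import Literature.AnabelianGeometry.AbsoluteAnabelian.CuspidalizationFactsModel
import Literature.AnabelianGeometry.AbsoluteAnabelian.AbsTopIChainsCuspidalFacts
import Literature.AnabelianGeometry.AbsoluteAnabelian.AbsTopII.InertiaDecompositionCore
import HarnessLib

/-!
# [GalSect] Thm. 1.3 (ii), cusp clause (FACT-LIST F-0103 / F-0084): its typed form IMPLIES
# [AbsTopI] Lem. 4.5 (vi), [AbsTopIII] Thm. 1.11 (b) and [AbsAnab] Lem. 1.3.7 as typed (F-0207 / F-0405 / F-0003)

Proof-only companion of `GaloisSectionsFacts.lean` / `CuspidalizationFactsModel.lean` (abc-iut-L4 lineage,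
p405486 / p406112; imported, never edited).  S. Mochizuki, *Galois sections in absolute anabelian
geometry*, Nagoya Math. J. 179 (2005) [GalSect], Thm. 1.3 (ii) p. 6: "The subgroup `D_x` is commensurably
terminal in `Π_{X_K}`.  If `x` is a cusp, then `D_x = C_{Π_{X_K}}(H)` for any open subgroup `H ⊆ I_x`."
Cell abc-iut, block F (fact-proving wave), seat abc-iut-f-094 (FLOAT after tranche 94).

`GalSect.Thm_1_3_ii_cusps C` types the two sentences as a conjunction: (1) every cuspidal `D_x` is
commensurably terminal; (2) `C_Π(H) = D_x` for every closed `H ≤ I_x` of finite index in `I_x`.  This file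
records, in kernel, three facts about that typing (pure group theory over `Δ ⊴ Π`):

* `GalSect.decompEqCommensuratorOfInertia_of_forall_commensurator_eq` — clause (2) at `H = I_x = D_x ∩ Δ`
  IS [AbsTopI] Lemma 4.5 (vi) as typed (`CuspidalData.DecompEqCommensuratorOfInertia`, F-0207:
  "`I = C_Π(I ∩ Δ)`");
* `GalSect.thm_1_3_ii_cusps_iff` — clause (1) is REDUNDANT: `Thm_1_3_ii_cusps C ↔ (2)`.  Indeed
  `C_Π(D_x) ≤ C_Π(D_x ∩ Δ)` for the normal subgroup `Δ` (abc-iut's `commensurator_le_commensurator_inf_normal`,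
  `AbsTopII/InertiaDecompositionCore.lean`), and `C_Π(D_x ∩ Δ) = C_Π(I_x) = D_x` by (2); so the typing is
  faithful to print, where the second sentence indeed subsumes the first at cusps;
* `GalSect.Thm_1_3_ii_cusps.decompEqNormalizer` / `.inertiaCommensurablyTerminal` — via abc-iut-f-060's
  structure theorem `CuspidalData.decompEqCommensuratorOfInertia_iff` (`AbsTopIChainsCuspidalFacts.lean`),
  the typed Thm. 1.3 (ii) yields [AbsTopIII] Thm. 1.11 (b) as typed (`CuspidalData.DecompEqNormalizer`,
  F-0405: "`D_x` … may then be constructed as the normalizer [or, equivalently, commensurator] of `I_x` in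
  `Π_{η_X}` [cf., e.g., [Mzk12], Theorem 1.3, (ii)]" — print's OWN citation of [GalSect] = [Mzk12] for this
  clause, [AbsTopIII] p. 46) and [AbsAnab] Lemma 1.3.7 as typed (`CuspidalData.InertiaCommensurablyTerminal`,
  F-0003).
* Model level (`GalSect.Thm_1_3_ii_model.decompEqNormalizer` etc.): for every interface `M : CurveModel`,
  the model-relative F-0084 `Thm_1_3_ii_model M hclosed` implies the instances of F-0207 / F-0405 / F-0003 at
  the cuspidal data of EVERY curve of `M` over an MLF — so a consumer assuming F-0084 at a named model need not
  assume those three rows there separately (one assumption label instead of four, at MLF curves).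

HONEST FRAMING: implications between the cell's TYPED predicates (assumption labels), proved by elementary
group theory; nothing of [GalSect] / [AbsTopI] / [AbsTopIII] / [AbsAnab] is proved as a statement about
curves; refereed results typed statements-first (D-0014); typed ≠ proved; no model of any curve is asserted
to exist; nothing here bears on the disputed [IUTchIII] Cor. 3.12; no side taken.
-/

noncomputable section

open scoped Classical Pointwise

namespace Literature.AnabelianGeometry.AbsoluteAnabelian

universe u

/-! ### A commensurable-terminality criterion through a normal subgroup -/

/-- If `C_G(D ∩ N) = D` for a normal subgroup `N ⊴ G`, then `D` is commensurably terminal: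
`D ≤ C_G(D) ≤ C_G(D ∩ N) = D` (private helper). [folklore] -/
private theorem isCommensurablyTerminal_of_commensurator_inf_normal_eq {G : Type u} [Group G]
    (D N : Subgroup G) [N.Normal] (h : Subgroup.Commensurable.commensurator (D ⊓ N) = D) :
    IsCommensurablyTerminal D :=
  ⟨le_antisymm ((commensurator_le_commensurator_inf_normal D N).trans h.le)
    (Anabelioids.le_commensurator D)⟩

namespace GalSect

open AbsTopIII FundamentalExtension

variable {E : FundamentalExtension.{u}} (C : E.CuspidalData)

/-! ### Clause (2) of the typed Thm. 1.3 (ii) at `H = I_x` is [AbsTopI] Lemma 4.5 (vi) as typed -/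

/-- **Clause (2) ⇒ [AbsTopI] Lem. 4.5 (vi) as typed (F-0207).**  "`D_x = C_Π(H)` for any open subgroup
`H ⊆ I_x`", applied to `H = I_x = D_x ∩ Δ` itself (closed, of index `1` in `I_x`), gives `D_x = C_Π(D_x ∩ Δ)`.
[cite: MochizukiGalSect2005, Thm 1.3 (ii) p.6] -/
theorem decompEqCommensuratorOfInertia_of_forall_commensurator_eq
    (h : ∀ (x : C.Cusp) (H : Subgroup E.arith), H ≤ C.Icusp x → IsClosed (H : Set E.arith) →
      (H.subgroupOf (C.Icusp x)).FiniteIndex → Subgroup.Commensurable.commensurator H = C.Dcusp x) :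
    C.DecompEqCommensuratorOfInertia := fun x => by
  rw [← C.Icusp_eq x]
  refine (h x (C.Icusp x) le_rfl (C.isClosed_Icusp x) ?_).symm
  rw [Subgroup.subgroupOf_self]
  infer_instance

/-- **The typed Thm. 1.3 (ii), cusp part, is EQUIVALENT to its clause (2) alone**: commensurable
terminality of `D_x` (clause (1)) follows from `C_Π(I_x) = D_x`, because `C_Π(D_x) ≤ C_Π(D_x ∩ Δ) = C_Π(I_x)`
(`Δ ⊴ Π`). [cite: MochizukiGalSect2005, Thm 1.3 (ii) p.6] -/
theorem thm_1_3_ii_cusps_iff :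
    Thm_1_3_ii_cusps C ↔
      ∀ (x : C.Cusp) (H : Subgroup E.arith), H ≤ C.Icusp x → IsClosed (H : Set E.arith) →
        (H.subgroupOf (C.Icusp x)).FiniteIndex → Subgroup.Commensurable.commensurator H = C.Dcusp x := by
  refine ⟨fun h => h.2, fun h => ⟨fun x => ?_, h⟩⟩
  exact isCommensurablyTerminal_of_commensurator_inf_normal_eq (C.Dcusp x) E.geom
    (decompEqCommensuratorOfInertia_of_forall_commensurator_eq C h x).symm

/-- Clause (2) alone already gives the typed Thm. 1.3 (ii), cusp part.
[cite: MochizukiGalSect2005, Thm 1.3 (ii) p.6] -/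
theorem thm_1_3_ii_cusps_of_forall_commensurator_eq
    (h : ∀ (x : C.Cusp) (H : Subgroup E.arith), H ≤ C.Icusp x → IsClosed (H : Set E.arith) →
      (H.subgroupOf (C.Icusp x)).FiniteIndex → Subgroup.Commensurable.commensurator H = C.Dcusp x) :
    Thm_1_3_ii_cusps C :=
  (thm_1_3_ii_cusps_iff C).2 h

/-! ### Consequences of the typed Thm. 1.3 (ii) for the cuspidal data (F-0207, F-0405, F-0003) -/

/-- **[GalSect] Thm. 1.3 (ii) (typed, cusps) ⇒ [AbsTopI] Lem. 4.5 (vi) (typed)**: `D_x = C_Π(D_x ∩ Δ)`.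
[cite: MochizukiGalSect2005, Thm 1.3 (ii) p.6] -/
theorem Thm_1_3_ii_cusps.decompEqCommensuratorOfInertia (h : Thm_1_3_ii_cusps C) :
    C.DecompEqCommensuratorOfInertia :=
  decompEqCommensuratorOfInertia_of_forall_commensurator_eq C h.2

/-- **[GalSect] Thm. 1.3 (ii) (typed, cusps) ⇒ [AbsTopIII] Thm. 1.11 (b) (typed, F-0405)**:
`D_x = N_Π(I_x)` — the clause [AbsTopIII] p. 46 justifies by "[cf., e.g., [Mzk12], Theorem 1.3, (ii)]".
[cite: MochizukiGalSect2005, Thm 1.3 (ii) p.6] -/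
theorem Thm_1_3_ii_cusps.decompEqNormalizer (h : Thm_1_3_ii_cusps C) : C.DecompEqNormalizer :=
  C.decompEqNormalizer_of_decompEqCommensuratorOfInertia (Thm_1_3_ii_cusps.decompEqCommensuratorOfInertia C h)

/-- **[GalSect] Thm. 1.3 (ii) (typed, cusps) ⇒ [AbsAnab] Lem. 1.3.7 (typed, F-0003)**: the inertia groups
`I_x` are commensurably terminal in `Δ`. [cite: MochizukiGalSect2005, Thm 1.3 (ii) p.6] -/
theorem Thm_1_3_ii_cusps.inertiaCommensurablyTerminal (h : Thm_1_3_ii_cusps C) :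
    C.InertiaCommensurablyTerminal :=
  C.inertiaCommensurablyTerminal_of_decompEqCommensuratorOfInertia
    (Thm_1_3_ii_cusps.decompEqCommensuratorOfInertia C h)

/-! ### Model level: F-0084 implies F-0207 / F-0405 / F-0003 at every MLF curve of the interface -/

/-- **F-0084 ⇒ F-0207 at MLF curves**: for every interface `M : CurveModel`, the model-relative [GalSect]
Thm. 1.3 (ii) gives `D_x = C_Π(D_x ∩ Δ)` for the cuspidal data of every curve of `M` over an MLF.
[cite: MochizukiGalSect2005, Thm 1.3 (ii) p.6] -/
theorem Thm_1_3_ii_model.decompEqCommensuratorOfInertia {M : CurveModel.{u}}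
    {hclosed : ∀ (U : M.Curve) (x : M.Point U), IsClosed (M.decomp U x : Set (M.ext U).arith)}
    (h : Thm_1_3_ii_model M hclosed) (U : M.Curve) (hU : IsMLF (M.base U)) :
    (M.cusps U).DecompEqCommensuratorOfInertia :=
  Thm_1_3_ii_cusps.decompEqCommensuratorOfInertia (M.cusps U) (h U hU).2

/-- **F-0084 ⇒ F-0405 at MLF curves**: for every interface `M : CurveModel`, the model-relative [GalSect]
Thm. 1.3 (ii) gives [AbsTopIII] Thm. 1.11 (b)'s `D_x = N_Π(I_x)` for the cuspidal data of every curve of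
`M` over an MLF (as print's citation of [Mzk12] Thm. 1.3 (ii) on [AbsTopIII] p. 46 says).
[cite: MochizukiGalSect2005, Thm 1.3 (ii) p.6] -/
theorem Thm_1_3_ii_model.decompEqNormalizer {M : CurveModel.{u}}
    {hclosed : ∀ (U : M.Curve) (x : M.Point U), IsClosed (M.decomp U x : Set (M.ext U).arith)}
    (h : Thm_1_3_ii_model M hclosed) (U : M.Curve) (hU : IsMLF (M.base U)) :
    (M.cusps U).DecompEqNormalizer :=
  Thm_1_3_ii_cusps.decompEqNormalizer (M.cusps U) (h U hU).2

/-- **F-0084 ⇒ F-0003 at MLF curves**: for every interface `M : CurveModel`, the model-relative [GalSect]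
Thm. 1.3 (ii) gives [AbsAnab] Lem. 1.3.7's `C_Δ(I_x) = I_x` for the cuspidal data of every curve of `M`
over an MLF. [cite: MochizukiGalSect2005, Thm 1.3 (ii) p.6] -/
theorem Thm_1_3_ii_model.inertiaCommensurablyTerminal {M : CurveModel.{u}}
    {hclosed : ∀ (U : M.Curve) (x : M.Point U), IsClosed (M.decomp U x : Set (M.ext U).arith)}
    (h : Thm_1_3_ii_model M hclosed) (U : M.Curve) (hU : IsMLF (M.base U)) :
    (M.cusps U).InertiaCommensurablyTerminal :=
  Thm_1_3_ii_cusps.inertiaCommensurablyTerminal (M.cusps U) (h U hU).2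

end GalSect

end Literature.AnabelianGeometry.AbsoluteAnabelian

end
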